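import Literature.MathematicalPhysics.QuantumFieldTheory.WilsonPartitionTubeForm
import Literature.MathematicalPhysics.QuantumFieldTheory.WilsonPartitionLocalResolution
import Literature.AlgebraicGeometry.RealAlgebraic.HomogeneousAlgebraicModel
import Literature.AlgebraicGeometry.RealAlgebraic.RealPointsResolutionData
import Literature.Analysis.Calculus.ResolutionDataTransport
import Literature.RepresentationTheory.CompactGroups.PolynomialFunctionsUnitaryGroup
import HarnessLib

/-!
# `WilsonPartitionRegularVariation` holds

Discharge of the named fact `WilsonPartitionRegularVariation` (regular variation at zero
temperature of the fixed-torus Wilson partition function of a compact group with a faithful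
continuous unitary representation): `WilsonPartitionRegularVariation_holds`.

The printed proofs (Arnold–Gusein-Zade–Varchenko II, Part II §7.3 Thms. 7.5–7.6; Watanabe 2009,
Thm. 7.1; Lin 2017, Thm. 2.9) rest on Hironaka's resolution of the singularities of the
real-analytic phase. The tree has reduced the fact to Laplace asymptotics at each zero of the phase
given resolution data there for the families `(f, g or f) ∘ (affine chart)`
(`laplaceAsymptotics_of_localResolution`), has the Wilson integral as a Laplace integral over the
tube `Ω = {M ∈ T : G(a M) ≥ 0}` of the compact linear group `H = ρ^E(G^E)` with phase `S ∘ q`,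
`S`, `G` polynomial (`exists_partitionFunction_eq_tubeIntegral`), and PROVES resolution of
singularities for regular functions on smooth real algebraic varieties
(`RealPoints.exists_resolutionData`, from Kollár's algebraic log resolution). This file supplies the
resolution data at a zero `x = h₀(1 + A₀)` algebraically:

* `C = H × 𝔨 ⊆ 𝔸 × 𝔸` is real Zariski closed (Chevalley: a compact linear group is the real zero
  set of the polynomials vanishing on it — `exists_poly_vanishing_on_range_ne_zero`, from the tree's
  `exists_aeval_coeFn_eq_zero_ne_zero` on the block-diagonal unitary group) and homogeneous under
  affine automorphisms `(M, A) ↦ (h M, A + B)` (`exists_affine_auto_of_mem_prod`), so it has a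
  smooth integral affine algebraic model `W` at `(h₀, A₀)` (`exists_smooth_algebraic_model`);
* the product map `Θ(M, A) = M(1 + A)` of the tube, read through the coordinate embedding
  `ι : W(ℝ) → C` and an analytic algebraic chart `e` of `W(ℝ)`, is a real-analytic diffeomorphism
  `Λ` from a neighbourhood of `e(Q₀)` in `ℝ^D` onto a neighbourhood of `x` (its inverse is
  `(q, a)` followed by the analytic extension of `e ∘ ι⁻¹`); under `Λ` the phase `S ∘ q` and the
  constraint `G ∘ a` become the REGULAR functions `S ∘ pr₁`, `G ∘ pr₂` on `W`;
* `exists_resolutionData` resolves them on `W(ℝ)`, and `Resolution.transport` moves the data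
  along `Λ`.

Everything is proved; no definitions, no named facts.

## References

* V. I. Arnold, S. M. Gusein-Zade, A. N. Varchenko, *Singularities of Differentiable Maps II*
  (2012), Part II §7.3, Thm. 7.5 §§1, 2, 4 and Thm. 7.6. [ArnoldGuseinzadeVarchenko2012]
* S. Watanabe, *Algebraic Geometry and Statistical Learning Theory* (2009), Thm. 2.8, Thm. 7.1.
  [WatanabeSumio2009]
* S. Lin, arXiv:1003.5338, Thm. 2.2, Cor. 2.3, Lemma 2.4, Thm. 2.9. [Lin2017]
* J. Kollár, *Lectures on Resolution of Singularities* (2007), Thm. 3.21. [Kollar2007]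
* C. Chevalley, *Theory of Lie Groups I* (1946), Ch. VI §§VIII–IX. [Chevalley1946]
-/

noncomputable section

open MeasureTheory Filter Set Topology Function
open scoped Matrix.Norms.Frobenius ENNReal ContDiff Manifold
open Literature.MeasureTheory.Group Literature.Analysis.Asymptotics
open Literature.RepresentationTheory.CompactGroups
open Literature.AlgebraicGeometry.Motives Literature.AlgebraicGeometry.RealAlgebraic
open Literature.Analysis.Calculus Literature.Analysis.Calculus.Resolution
open AlgebraicGeometry

namespace Literature.MathematicalPhysics.QuantumFieldTheory

section Separation

variable {G : Type} [Group G] [TopologicalSpace G] [IsTopologicalGroup G] [CompactSpace G]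

omit [IsTopologicalGroup G] in
-- The product topology of `(M_N(ℂ))^E` and the topology of its (Frobenius/sup) norm are only
-- reducibly-different instances (tree idiom, cf. `WilsonPartitionLaplaceForm.lean`).
set_option backward.isDefEq.respectTransparency false in
/-- **The compact linear group `ρ^E(G^E) ⊆ (M_N(ℂ))^E` is real Zariski closed** (Chevalley): every
tuple of matrices off `ρ^E(G^E)` is separated from it by a real polynomial function vanishing on
it. If all components are unitary this is the tree's real separation theorem
(`exists_aeval_coeFn_eq_zero_ne_zero`) for the closed subgroup of block-diagonal unitaries,
pulled back along the (linear) block-diagonal embedding; otherwise a unitarity relation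
`Re/Im ((M_e)ᴴ M_e - 1)ᵢⱼ` separates. [cite: Chevalley1946, Ch. VI §§VIII–IX] -/
theorem exists_poly_vanishing_on_range_ne_zero {E' : Type} [Fintype E'] [DecidableEq E']
    (r : LatticeRep G) (z : E' → Matrix (Fin r.N) (Fin r.N) ℂ)
    (hz : z ∉ Set.range (MonoidHom.compLeft r.ρ E')) :
    ∃ P : MvPolynomial ((E' → Matrix (Fin r.N) (Fin r.N) ℂ) →L[ℝ] ℝ) ℝ,
      (∀ U : E' → G, MvPolynomial.aeval (R := ℝ)
        (fun ℓ : (E' → Matrix (Fin r.N) (Fin r.N) ℂ) →L[ℝ] ℝ =>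
          (ℓ : (E' → Matrix (Fin r.N) (Fin r.N) ℂ) → ℝ)) P (MonoidHom.compLeft r.ρ E' U) = 0) ∧
      MvPolynomial.aeval (R := ℝ)
        (fun ℓ : (E' → Matrix (Fin r.N) (Fin r.N) ℂ) →L[ℝ] ℝ =>
          (ℓ : (E' → Matrix (Fin r.N) (Fin r.N) ℂ) → ℝ)) P z ≠ 0 := by
  classical
  set ρE : (E' → G) →* (E' → Matrix (Fin r.N) (Fin r.N) ℂ) := MonoidHom.compLeft r.ρ E' with hρE
  have hρEapply : ∀ (U : E' → G) (e : E'), ρE U e = r.ρ (U e) := fun U e => rfl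
  by_cases hunit : ∀ e, z e ∈ Matrix.unitaryGroup (Fin r.N) ℂ
  · -- the block-diagonal embedding
    let βₗ : (E' → Matrix (Fin r.N) (Fin r.N) ℂ) →ₗ[ℝ] Matrix (Fin r.N × E') (Fin r.N × E') ℂ :=
      { toFun := fun M => Matrix.blockDiagonal M
        map_add' := fun M N => Matrix.blockDiagonal_add M N
        map_smul' := fun c M => Matrix.blockDiagonal_smul c M }
    set β : (E' → Matrix (Fin r.N) (Fin r.N) ℂ) →L[ℝ] Matrix (Fin r.N × E') (Fin r.N × E') ℂ :=
      LinearMap.toContinuousLinearMap βₗ with hβ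
    have hβapply : ∀ M, β M = Matrix.blockDiagonal M := fun M => rfl
    have hβmul : ∀ M N : E' → Matrix (Fin r.N) (Fin r.N) ℂ, β (M * N) = β M * β N := fun M N => by
      rw [hβapply, hβapply, hβapply, ← Matrix.blockDiagonal_mul]; rfl
    have hβone : β 1 = 1 := by rw [hβapply, Matrix.blockDiagonal_one]
    have hβstar : ∀ M : E' → Matrix (Fin r.N) (Fin r.N) ℂ, star (β M) = β (star M) := fun M => by
      rw [hβapply, hβapply, Matrix.star_eq_conjTranspose, Matrix.blockDiagonal_conjTranspose]; rfl
    have hβunit : ∀ M : E' → Matrix (Fin r.N) (Fin r.N) ℂ,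
        (∀ e, M e ∈ Matrix.unitaryGroup (Fin r.N) ℂ) →
          β M ∈ Matrix.unitaryGroup (Fin r.N × E') ℂ := by
      intro M hM
      rw [Matrix.mem_unitaryGroup_iff, hβstar, ← hβmul]
      have : M * star M = 1 := by
        funext e
        exact Matrix.mem_unitaryGroup_iff.1 (hM e)
      rw [this, hβone]
    -- the closed subgroup of block-diagonal unitaries coming from `G^E`
    let ρU : (E' → G) →* Matrix.unitaryGroup (Fin r.N × E') ℂ :=
      { toFun := fun U => ⟨β (ρE U), hβunit _ fun e => by rw [hρEapply]; exact r.mem_unitary _⟩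
        map_one' := Subtype.ext (by simp only [map_one, hβone]; rfl)
        map_mul' := fun U V => Subtype.ext (by
          simp only [map_mul, hβmul]; rfl) }
    have hρUval : ∀ U, ((ρU U : Matrix.unitaryGroup (Fin r.N × E') ℂ) :
        Matrix (Fin r.N × E') (Fin r.N × E') ℂ) = β (ρE U) := fun U => rfl
    have hρUc : Continuous ρU := by
      refine Continuous.subtype_mk ?_ _
      exact β.continuous.comp (continuous_pi fun e => r.continuous.comp (continuous_apply e))
    set K : Subgroup (Matrix.unitaryGroup (Fin r.N × E') ℂ) := ρU.range with hK
    have hKc : IsClosed (K : Set (Matrix.unitaryGroup (Fin r.N × E') ℂ)) := by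
      rw [hK, MonoidHom.coe_range]
      exact (isCompact_range hρUc).isClosed
    -- the point `β z ∉ K`
    set xU : Matrix.unitaryGroup (Fin r.N × E') ℂ := ⟨β z, hβunit z hunit⟩ with hxU
    have hxK : xU ∉ K := by
      rintro ⟨U, hU⟩
      apply hz
      refine ⟨U, ?_⟩
      have h1 : β (ρE U) = β z := by
        have := congrArg (fun k : Matrix.unitaryGroup (Fin r.N × E') ℂ =>
          (k : Matrix (Fin r.N × E') (Fin r.N × E') ℂ)) hU
        simpa only [hρUval] using this
      rw [hβapply, hβapply] at h1
      exact Matrix.blockDiagonal_injective h1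
    obtain ⟨gen, hgre, hgim⟩ := exists_gen (n := Fin r.N × E')
    obtain ⟨P, hPK, hPx⟩ := exists_aeval_coeFn_eq_zero_ne_zero gen hgre hgim K hKc hxK
    obtain ⟨P', hP'⟩ := exists_aeval_coeFn_eq_comp_clm (E := E' → Matrix (Fin r.N) (Fin r.N) ℂ)
      ⟨P, fun y => rfl⟩ β
    refine ⟨P', fun U => ?_, ?_⟩
    · rw [hP', ← hρUval]
      exact hPK (ρU U) ⟨U, rfl⟩
    · rw [hP']
      exact hPx
  · -- a non-unitary component: a unitarity relation separates
    push Not at hunit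
    obtain ⟨e, he⟩ := hunit
    rw [Matrix.mem_unitaryGroup_iff'] at he
    obtain ⟨i, j, hij⟩ : ∃ i j, (star (z e) * z e) i j ≠ (1 : Matrix (Fin r.N) (Fin r.N) ℂ) i j := by
      by_contra h
      push Not at h
      exact he (Matrix.ext fun i j => h i j)
    rw [Matrix.star_eq_conjTranspose] at hij
    obtain ⟨⟨Pre, hPre⟩, ⟨Pim, hPim⟩⟩ := exists_aeval_coeFn_eq_conjTranspose_mul (n := Fin r.N) i j
    set proj : (E' → Matrix (Fin r.N) (Fin r.N) ℂ) →L[ℝ] Matrix (Fin r.N) (Fin r.N) ℂ :=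
      ContinuousLinearMap.proj (R := ℝ) (φ := fun _ : E' => Matrix (Fin r.N) (Fin r.N) ℂ) e
      with hproj
    -- on `ρ^E(G^E)` the relation holds
    have hrel : ∀ U : E' → G, ((ρE U e).conjTranspose * ρE U e) i j =
        (1 : Matrix (Fin r.N) (Fin r.N) ℂ) i j := by
      intro U
      have hu := Matrix.mem_unitaryGroup_iff'.1 (r.mem_unitary (U e))
      rw [Matrix.star_eq_conjTranspose] at hu
      rw [hρEapply, hu]
    rcases Complex.ext_iff.not.1 hij |> not_and_or.1 with hre | him
    · obtain ⟨Q, hQ⟩ := exists_aeval_coeFn_eq_sub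
        (exists_aeval_coeFn_eq_comp_clm (E := E' → Matrix (Fin r.N) (Fin r.N) ℂ) ⟨Pre, hPre⟩ proj)
        (exists_aeval_coeFn_eq_const (E := E' → Matrix (Fin r.N) (Fin r.N) ℂ)
          (((1 : Matrix (Fin r.N) (Fin r.N) ℂ) i j).re))
      refine ⟨Q, fun U => ?_, ?_⟩
      · rw [hQ, sub_eq_zero]
        change (((proj (ρE U)).conjTranspose * proj (ρE U)) i j).re = _
        rw [show proj (ρE U) = ρE U e from rfl, hrel]
      · rw [hQ, sub_ne_zero]
        exact hre
    · obtain ⟨Q, hQ⟩ := exists_aeval_coeFn_eq_sub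
        (exists_aeval_coeFn_eq_comp_clm (E := E' → Matrix (Fin r.N) (Fin r.N) ℂ) ⟨Pim, hPim⟩ proj)
        (exists_aeval_coeFn_eq_const (E := E' → Matrix (Fin r.N) (Fin r.N) ℂ)
          (((1 : Matrix (Fin r.N) (Fin r.N) ℂ) i j).im))
      refine ⟨Q, fun U => ?_, ?_⟩
      · rw [hQ, sub_eq_zero]
        change (((proj (ρE U)).conjTranspose * proj (ρE U)) i j).im = _
        rw [show proj (ρE U) = ρE U e from rfl, hrel]
      · rw [hQ, sub_ne_zero]
        exact him

omit [IsTopologicalGroup G] [CompactSpace G] in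
-- Same topology-instance bridge as above.
set_option backward.isDefEq.respectTransparency false in
/-- **Homogeneity of `H × 𝔨`**: for `H = ρ^E(G^E)` and a subspace `𝔨`, the affine automorphisms
`(M, A) ↦ (h M, A + B)` (`h ∈ H`, `B ∈ 𝔨`) of `𝔸 × 𝔸` preserve `C = H × 𝔨` and act transitively
on it. [folklore] -/
theorem exists_affine_auto_of_mem_prod {E' : Type} [Fintype E'] [DecidableEq E']
    (r : LatticeRep G) (𝔨 : Submodule ℝ (E' → Matrix (Fin r.N) (Fin r.N) ℂ)) :
    ∀ c ∈ {z : (E' → Matrix (Fin r.N) (Fin r.N) ℂ) × (E' → Matrix (Fin r.N) (Fin r.N) ℂ) |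
        z.1 ∈ Set.range (MonoidHom.compLeft r.ρ E') ∧ z.2 ∈ 𝔨},
    ∀ c' ∈ {z : (E' → Matrix (Fin r.N) (Fin r.N) ℂ) × (E' → Matrix (Fin r.N) (Fin r.N) ℂ) |
        z.1 ∈ Set.range (MonoidHom.compLeft r.ρ E') ∧ z.2 ∈ 𝔨},
      ∃ (A : ((E' → Matrix (Fin r.N) (Fin r.N) ℂ) × (E' → Matrix (Fin r.N) (Fin r.N) ℂ)) ≃L[ℝ]
          ((E' → Matrix (Fin r.N) (Fin r.N) ℂ) × (E' → Matrix (Fin r.N) (Fin r.N) ℂ)))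
        (v : (E' → Matrix (Fin r.N) (Fin r.N) ℂ) × (E' → Matrix (Fin r.N) (Fin r.N) ℂ)),
        (∀ x ∈ {z : (E' → Matrix (Fin r.N) (Fin r.N) ℂ) × (E' → Matrix (Fin r.N) (Fin r.N) ℂ) |
            z.1 ∈ Set.range (MonoidHom.compLeft r.ρ E') ∧ z.2 ∈ 𝔨}, A x + v ∈
          {z : (E' → Matrix (Fin r.N) (Fin r.N) ℂ) × (E' → Matrix (Fin r.N) (Fin r.N) ℂ) |
            z.1 ∈ Set.range (MonoidHom.compLeft r.ρ E') ∧ z.2 ∈ 𝔨}) ∧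
        (∀ x ∈ {z : (E' → Matrix (Fin r.N) (Fin r.N) ℂ) × (E' → Matrix (Fin r.N) (Fin r.N) ℂ) |
            z.1 ∈ Set.range (MonoidHom.compLeft r.ρ E') ∧ z.2 ∈ 𝔨}, A.symm x + -A.symm v ∈
          {z : (E' → Matrix (Fin r.N) (Fin r.N) ℂ) × (E' → Matrix (Fin r.N) (Fin r.N) ℂ) |
            z.1 ∈ Set.range (MonoidHom.compLeft r.ρ E') ∧ z.2 ∈ 𝔨}) ∧
        A c + v = c' := by
  rintro ⟨M, B⟩ ⟨⟨U, rfl⟩, hB⟩ ⟨M', B'⟩ ⟨⟨U', rfl⟩, hB'⟩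
  set ρE := MonoidHom.compLeft r.ρ E' with hρE
  set h : E' → Matrix (Fin r.N) (Fin r.N) ℂ := ρE (U' * U⁻¹) with hh
  set hi : E' → Matrix (Fin r.N) (Fin r.N) ℂ := ρE (U * U'⁻¹) with hhi
  have h1 : hi * h = 1 := by
    rw [hh, hhi, ← map_mul, show U * U'⁻¹ * (U' * U⁻¹) = 1 by group, map_one]
  have h2 : h * hi = 1 := by
    rw [hh, hhi, ← map_mul, show U' * U⁻¹ * (U * U'⁻¹) = 1 by group, map_one]
  set Lh : (E' → Matrix (Fin r.N) (Fin r.N) ℂ) →L[ℝ] (E' → Matrix (Fin r.N) (Fin r.N) ℂ) :=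
    ContinuousLinearMap.mul ℝ (E' → Matrix (Fin r.N) (Fin r.N) ℂ) h with hLh
  set Lhi : (E' → Matrix (Fin r.N) (Fin r.N) ℂ) →L[ℝ] (E' → Matrix (Fin r.N) (Fin r.N) ℂ) :=
    ContinuousLinearMap.mul ℝ (E' → Matrix (Fin r.N) (Fin r.N) ℂ) hi with hLhi
  have hLh_apply : ∀ N, Lh N = h * N := fun N => rfl
  have hLhi_apply : ∀ N, Lhi N = hi * N := fun N => rfl
  set Eh : (E' → Matrix (Fin r.N) (Fin r.N) ℂ) ≃L[ℝ] (E' → Matrix (Fin r.N) (Fin r.N) ℂ) :=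
    ContinuousLinearEquiv.equivOfInverse Lh Lhi
      (fun N => by rw [hLhi_apply, hLh_apply, ← mul_assoc, h1, one_mul])
      (fun N => by rw [hLh_apply, hLhi_apply, ← mul_assoc, h2, one_mul]) with hEh
  have hEh_apply : ∀ N, Eh N = h * N := fun N => rfl
  have hEh_symm : ∀ N, Eh.symm N = hi * N := fun N => rfl
  set A := Eh.prodCongr (ContinuousLinearEquiv.refl ℝ (E' → Matrix (Fin r.N) (Fin r.N) ℂ)) with hA
  have hA_apply : ∀ N D, A (N, D) = (h * N, D) := fun N D => rfl
  have hA_symm : ∀ N D, A.symm (N, D) = (hi * N, D) := fun N D => rfl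
  refine ⟨A, (0, B' - B), ?_, ?_, ?_⟩
  · rintro ⟨N, D⟩ ⟨⟨V, rfl⟩, hD⟩
    rw [hA_apply, Prod.mk_add_mk, add_zero]
    refine ⟨⟨U' * U⁻¹ * V, by rw [hh, ← map_mul]⟩, ?_⟩
    exact 𝔨.add_mem hD (𝔨.sub_mem hB' hB)
  · rintro ⟨N, D⟩ ⟨⟨V, rfl⟩, hD⟩
    rw [hA_symm, hA_symm, Prod.neg_mk, Prod.mk_add_mk, mul_zero, neg_zero, add_zero]
    refine ⟨⟨U * U'⁻¹ * V, by rw [hhi, ← map_mul]⟩, ?_⟩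
    exact 𝔨.add_mem hD (𝔨.neg_mem (𝔨.sub_mem hB' hB))
  · rw [hA_apply, Prod.mk_add_mk, add_zero, add_sub_cancel, hh, ← map_mul, inv_mul_cancel_right]

end Separation

section Tools

/-- A map into a finite-dimensional space all of whose linear coordinates are analytic is
analytic. [folklore] -/
private theorem analyticOnNhd_of_eval_clm {𝔼 X : Type*} [NormedAddCommGroup 𝔼] [NormedSpace ℝ 𝔼]
    [FiniteDimensional ℝ 𝔼] [NormedAddCommGroup X] [NormedSpace ℝ X] {f : X → 𝔼} {s : Set X}
    (h : ∀ ℓ : 𝔼 →L[ℝ] ℝ, AnalyticOnNhd ℝ (fun u => ℓ (f u)) s) : AnalyticOnNhd ℝ f s := by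
  set b := Module.finBasis ℝ 𝔼 with hb
  have hf : f = fun u => ∑ i, b.equivFun (f u) i • b i := by
    funext u
    exact (b.sum_equivFun (f u)).symm
  rw [hf]
  refine Finset.analyticOnNhd_fun_sum _ fun i _ => ?_
  have key := (h ((ContinuousLinearMap.proj i).comp
    (b.equivFunL : 𝔼 →L[ℝ] (Fin (Module.finrank ℝ 𝔼) → ℝ)))).smul
    (analyticOnNhd_const (v := b i) (s := s))
  exact key

/-- Two maps between coordinate spaces which are differentiable local inverses of each other
at a point force the dimensions to agree. [folklore] -/
private theorem eq_of_localInverse {m n : ℕ} {Λ : (Fin m → ℝ) → (Fin n → ℝ)}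
    {Λ' : (Fin n → ℝ) → (Fin m → ℝ)} {u : Fin m → ℝ}
    (hΛ : DifferentiableAt ℝ Λ u) (hΛ' : DifferentiableAt ℝ Λ' (Λ u))
    (h₁ : ∀ᶠ w in 𝓝 u, Λ' (Λ w) = w) (h₂ : ∀ᶠ v in 𝓝 (Λ u), Λ (Λ' v) = v) : m = n := by
  have hc₁ : HasFDerivAt (Λ' ∘ Λ) ((fderiv ℝ Λ' (Λ u)).comp (fderiv ℝ Λ u)) u :=
    hΛ'.hasFDerivAt.comp u hΛ.hasFDerivAt
  have hid₁ : HasFDerivAt (Λ' ∘ Λ) (ContinuousLinearMap.id ℝ _) u :=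
    (hasFDerivAt_id u).congr_of_eventuallyEq (h₁.mono fun w hw => hw)
  have e₁ := hc₁.unique hid₁
  have hu : Λ' (Λ u) = u := h₁.self_of_nhds
  have hΛu : DifferentiableAt ℝ Λ (Λ' (Λ u)) := by rw [hu]; exact hΛ
  have hc₂ : HasFDerivAt (Λ ∘ Λ') ((fderiv ℝ Λ (Λ' (Λ u))).comp (fderiv ℝ Λ' (Λ u))) (Λ u) :=
    hΛu.hasFDerivAt.comp (Λ u) hΛ'.hasFDerivAt
  rw [hu] at hc₂
  have hid₂ : HasFDerivAt (Λ ∘ Λ') (ContinuousLinearMap.id ℝ _) (Λ u) :=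
    (hasFDerivAt_id _).congr_of_eventuallyEq (h₂.mono fun v hv => hv)
  have e₂ := hc₂.unique hid₂
  have eqv : (Fin m → ℝ) ≃L[ℝ] (Fin n → ℝ) :=
    ContinuousLinearEquiv.equivOfInverse (fderiv ℝ Λ u) (fderiv ℝ Λ' (Λ u))
      (fun w => by
        have := congrArg (fun T : (Fin m → ℝ) →L[ℝ] (Fin m → ℝ) => T w) e₁
        simpa using this)
      (fun v => by
        have := congrArg (fun T : (Fin n → ℝ) →L[ℝ] (Fin n → ℝ) => T v) e₂
        simpa using this)
  have := eqv.toLinearEquiv.finrank_eq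
  simpa [Module.finrank_fin_fun] using this

/-- An open partial homeomorphism from a pair of continuous maps inverse to each other on open
sets. [folklore] -/
private theorem exists_openPartialHomeomorph_of_inverses {X Y : Type*} [TopologicalSpace X]
    [TopologicalSpace Y] {f : X → Y} {g : Y → X} {O₁ : Set X} {O₂ : Set Y} (hO₁ : IsOpen O₁)
    (hO₂ : IsOpen O₂) (hf : ContinuousOn f O₁) (hg : ContinuousOn g O₂)
    (h₁ : ∀ u ∈ O₁, g (f u) = u) (h₂ : ∀ v ∈ O₂, f (g v) = v) :
    ∃ Λ : OpenPartialHomeomorph X Y, Λ.source = O₁ ∩ f ⁻¹' O₂ ∧ Λ.target = O₂ ∩ g ⁻¹' O₁ ∧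
      (Λ : X → Y) = f ∧ (Λ.symm : Y → X) = g :=
  ⟨{ toFun := f
     invFun := g
     source := O₁ ∩ f ⁻¹' O₂
     target := O₂ ∩ g ⁻¹' O₁
     map_source' := fun u hu => ⟨hu.2, show g (f u) ∈ O₁ by rw [h₁ u hu.1]; exact hu.1⟩
     map_target' := fun v hv => ⟨hv.2, show f (g v) ∈ O₂ by rw [h₂ v hv.1]; exact hv.1⟩
     left_inv' := fun u hu => h₁ u hu.1
     right_inv' := fun v hv => h₂ v hv.1
     open_source := hf.isOpen_inter_preimage hO₁ hO₂
     open_target := hg.isOpen_inter_preimage hO₂ hO₁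
     continuousOn_toFun := hf.mono inter_subset_left
     continuousOn_invFun := hg.mono inter_subset_left }, rfl, rfl, rfl, rfl⟩

/-- The zero section evaluates to zero. [folklore] -/
private theorem evalOrZero_zero {X : SchemeOver ℝ} (U : X.left.Opens) (Q : AlgPoints X ℝ) :
    AlgPoints.evalOrZero U (0 : Γ(X.left, U)) Q = 0 := by
  by_cases h : Q.pt ∈ U
  · rw [AlgPoints.evalOrZero_of_mem _ h, ← AlgPoints.evalRingHom_apply, map_zero]
  · exact AlgPoints.evalOrZero_of_not_mem _ h

end Tools

section Resolution

open Literature.AlgebraicGeometry.Motives.AlgPoints (evalOrZero evalOrZero_of_mem)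

set_option maxHeartbeats 1600000 in
-- one long geometric construction (model, chart, diffeomorphism, resolution, transport)
/-- **Resolution data for the Wilson phase at a point of the tube, algebraically.** In a
finite-dimensional real normed algebra `𝔸` let `C = H × 𝔨 ⊆ 𝔸 × 𝔸` (`H ⊆ 𝔸` a set, `𝔨` a
subspace) be real Zariski closed (`hsep`) and affinely homogeneous (`hhom`); let `T ⊆ 𝔸` be an
open tube over `C` with analytic projections `q`, `a` (`q(h(1+A)) = h`, `a(h(1+A)) = A`,
`M = q M (1 + a M)`), and `S`, `G` polynomial functions on `𝔸`. Then at every `x ∈ T`, in every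
affine chart `v ↦ x + T⁻¹v` of `𝔸`, every pair of functions `F₀, F₁` each of which is
`S ∘ q ∘ (x + T⁻¹·)` or `G ∘ a ∘ (x + T⁻¹·)`, analytic and not identically zero on a connected
open `V ∋ 0`, admits resolution data over an open `W ∋ 0`, `W ⊆ V` (hypothesis `hRx` of
`laplaceAsymptotics_of_localResolution`). Proof: smooth integral algebraic model `W` of `C` at
`(q x, a x)` (`exists_smooth_algebraic_model`), analytic identification `Λ` of a chart
neighbourhood of `W(ℝ)` with a neighbourhood of `x` through `(M, A) ↦ M(1 + A)` (inverse
`(q, a)`), under which the `Fᵢ` become regular functions; `RealPoints.exists_resolutionData`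
(Kollár's log resolution) and `Resolution.transport`.
[cite: ArnoldGuseinzadeVarchenko2012, Part II §7.3, proof of Thm. 7.5; Kollar2007, Thm. 3.21] -/
theorem exists_resolution_at
    {𝔸 : Type} [NormedRing 𝔸] [NormedAlgebra ℝ 𝔸] [FiniteDimensional ℝ 𝔸]
    {H : Set 𝔸} {𝔨 : Submodule ℝ 𝔸} {rt : ℝ} {T : Set 𝔸} {q a : 𝔸 → 𝔸} {S Gc : 𝔸 → ℝ}
    (hsep : ∀ z ∉ {z : 𝔸 × 𝔸 | z.1 ∈ H ∧ z.2 ∈ 𝔨},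
      ∃ P : MvPolynomial ((𝔸 × 𝔸) →L[ℝ] ℝ) ℝ,
        (∀ c ∈ {z : 𝔸 × 𝔸 | z.1 ∈ H ∧ z.2 ∈ 𝔨},
          MvPolynomial.aeval (R := ℝ) (fun ℓ : (𝔸 × 𝔸) →L[ℝ] ℝ => (ℓ : 𝔸 × 𝔸 → ℝ)) P c = 0) ∧
        MvPolynomial.aeval (R := ℝ) (fun ℓ : (𝔸 × 𝔸) →L[ℝ] ℝ => (ℓ : 𝔸 × 𝔸 → ℝ)) P z ≠ 0)
    (hhom : ∀ c ∈ {z : 𝔸 × 𝔸 | z.1 ∈ H ∧ z.2 ∈ 𝔨}, ∀ c' ∈ {z : 𝔸 × 𝔸 | z.1 ∈ H ∧ z.2 ∈ 𝔨},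
      ∃ (A : (𝔸 × 𝔸) ≃L[ℝ] (𝔸 × 𝔸)) (v : 𝔸 × 𝔸),
        (∀ x ∈ {z : 𝔸 × 𝔸 | z.1 ∈ H ∧ z.2 ∈ 𝔨}, A x + v ∈ {z : 𝔸 × 𝔸 | z.1 ∈ H ∧ z.2 ∈ 𝔨}) ∧
        (∀ x ∈ {z : 𝔸 × 𝔸 | z.1 ∈ H ∧ z.2 ∈ 𝔨},
          A.symm x + (-A.symm v) ∈ {z : 𝔸 × 𝔸 | z.1 ∈ H ∧ z.2 ∈ 𝔨}) ∧ A c + v = c')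
    (hT : IsOpen T)
    (hqa : ∀ h ∈ H, ∀ A ∈ 𝔨, ‖A‖ < rt → q (h * (1 + A)) = h ∧ a (h * (1 + A)) = A)
    (hrep : ∀ M ∈ T, q M ∈ H ∧ a M ∈ 𝔨 ∧ ‖a M‖ < rt ∧ M = q M * (1 + a M))
    (hqan : AnalyticOnNhd ℝ q T) (haan : AnalyticOnNhd ℝ a T)
    {PS PG : MvPolynomial (𝔸 →L[ℝ] ℝ) ℝ}
    (hPS : ∀ M, MvPolynomial.aeval (R := ℝ) (fun ℓ : 𝔸 →L[ℝ] ℝ => (ℓ : 𝔸 → ℝ)) PS M = S M)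
    (hPG : ∀ M, MvPolynomial.aeval (R := ℝ) (fun ℓ : 𝔸 →L[ℝ] ℝ => (ℓ : 𝔸 → ℝ)) PG M = Gc M)
    {x : 𝔸} (hx : x ∈ T) {D : ℕ} (Taff : 𝔸 ≃L[ℝ] (Fin D → ℝ))
    {V : Set (Fin D → ℝ)} {F : Fin 2 → (Fin D → ℝ) → ℝ}
    (hV : IsOpen V) (hVc : IsPreconnected V) (h0V : (0 : Fin D → ℝ) ∈ V)
    (hFan : ∀ i, AnalyticOnNhd ℝ (F i) V) (hFne : ∀ i, ∃ v ∈ V, F i v ≠ 0)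
    (hFshape : ∀ i, (F i = fun v => S (q (x + Taff.symm v))) ∨
      ∃ _j : Fin 1, F i = fun v => Gc (a (x + Taff.symm v))) :
    ∃ (W : Set (Fin D → ℝ)) (M : Type) (_ : TopologicalSpace M) (_ : T2Space M)
      (_ : ChartedSpace (Fin D → ℝ) M) (_ : IsManifold 𝓘(ℝ, Fin D → ℝ) ω M)
      (gr : M → (Fin D → ℝ)),
      IsOpen W ∧ (0 : Fin D → ℝ) ∈ W ∧ W ⊆ V ∧ (∀ p, gr p ∈ W) ∧
      ContMDiff 𝓘(ℝ, Fin D → ℝ) 𝓘(ℝ, Fin D → ℝ) ω gr ∧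
      (∀ K ⊆ W, IsCompact K → IsCompact (gr ⁻¹' K)) ∧
      Set.BijOn gr {p | ∀ i, F i (gr p) ≠ 0} {x ∈ W | ∀ i, F i x ≠ 0} ∧
      ∀ p : M, (∃ i, F i (gr p) = 0) →
        ∃ ch : OpenPartialHomeomorph M (Fin D → ℝ),
          ch ∈ IsManifold.maximalAtlas 𝓘(ℝ, Fin D → ℝ) ω M ∧ p ∈ ch.source ∧ ch p = 0 ∧
          ∃ (k : Fin 2 → Fin D → ℕ) (h : Fin D → ℕ) (a : Fin 2 → (Fin D → ℝ) → ℝ)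
            (b : (Fin D → ℝ) → ℝ),
            (∀ i, AnalyticOnNhd ℝ (a i) ch.target) ∧ AnalyticOnNhd ℝ b ch.target ∧
            (∀ i, ∀ u ∈ ch.target, a i u ≠ 0) ∧ (∀ u ∈ ch.target, b u ≠ 0) ∧
            (∀ i, ∀ u ∈ ch.target, F i (gr (ch.symm u)) = a i u * ∏ j, u j ^ k i j) ∧
            (∀ u ∈ ch.target, (fderiv ℝ (gr ∘ ch.symm) u).det = b u * ∏ j, u j ^ h j) := by
  classical
  set C : Set (𝔸 × 𝔸) := {z : 𝔸 × 𝔸 | z.1 ∈ H ∧ z.2 ∈ 𝔨} with hC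
  obtain ⟨hqx, hax, haxr, hxeq⟩ := hrep x hx
  have hc₀ : (q x, a x) ∈ C := ⟨hqx, hax⟩
  ------------------------------------------------------------------
  -- Step 1: the smooth integral algebraic model `W` of `C` at `c₀ = (q x, a x)`
  ------------------------------------------------------------------
  obtain ⟨d, W, i1, i2, i3, i4, i5, i6, Q₀, ι, hιQ₀, hιcont, hιind, -, hιC, ⟨Oι, hOι, hrangeι⟩,
    hsec, hloc⟩ := exists_smooth_algebraic_model hsep hhom hc₀
  have hQ₀Oι : ι Q₀ ∈ Oι := by
    have h := mem_range_self (f := ι) Q₀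
    rw [hrangeι] at h
    exact h.2
  ------------------------------------------------------------------
  -- Step 2: the real-analytic manifold `W(ℝ)` and the chart `chart Q₀`
  ------------------------------------------------------------------
  obtain ⟨chart, cs, hM, hchart, -, mem, alg, hol⟩ := exists_chartedSpace_isManifold W d
  have htop : IsAffineOpen (⊤ : W.left.Opens) := isAffineOpen_top W.left
  set U₀ : W.left.affineOpens := ⟨⊤, htop⟩ with hU₀
  have hmemU₀ : ∀ Q : AlgPoints W ℝ, Q.pt ∈ (↑U₀ : W.left.Opens) := fun Q => trivial
  -- global sections representing `S ∘ pr₁` and `G ∘ pr₂`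
  obtain ⟨PS2, hPS2⟩ := exists_aeval_coeFn_eq_comp_clm
    (f := fun y : 𝔸 => MvPolynomial.aeval (R := ℝ) (fun ℓ : 𝔸 →L[ℝ] ℝ => (ℓ : 𝔸 → ℝ)) PS y)
    ⟨PS, fun _ => rfl⟩ (ContinuousLinearMap.fst ℝ 𝔸 𝔸)
  obtain ⟨PG2, hPG2⟩ := exists_aeval_coeFn_eq_comp_clm
    (f := fun y : 𝔸 => MvPolynomial.aeval (R := ℝ) (fun ℓ : 𝔸 →L[ℝ] ℝ => (ℓ : 𝔸 → ℝ)) PG y)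
    ⟨PG, fun _ => rfl⟩ (ContinuousLinearMap.snd ℝ 𝔸 𝔸)
  obtain ⟨sS, hsS⟩ := hsec PS2
  obtain ⟨sG, hsG⟩ := hsec PG2
  have hsS' : ∀ Q, evalOrZero (↑U₀ : W.left.Opens) sS Q = S (ι Q).1 := fun Q => by
    show evalOrZero (⊤ : W.left.Opens) sS Q = S (ι Q).1
    rw [hsS Q, hPS2, hPS]; rfl
  have hsG' : ∀ Q, evalOrZero (↑U₀ : W.left.Opens) sG Q = Gc (ι Q).2 := fun Q => by
    show evalOrZero (⊤ : W.left.Opens) sG Q = Gc (ι Q).2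
    rw [hsG Q, hPG2, hPG]; rfl
  -- `ι` is analytic in the chart `chart Q₀`
  have hιan : AnalyticOnNhd ℝ (ι ∘ (chart Q₀).symm) (chart Q₀).target := by
    refine analyticOnNhd_of_eval_clm fun ℓ => ?_
    obtain ⟨sℓ, hsℓ⟩ := hsec (MvPolynomial.X ℓ)
    intro u hu
    have hu' : u ∈ (chart Q₀).target ∩ (chart Q₀).symm ⁻¹' {Q | Q.pt ∈ (↑U₀ : W.left.Opens)} :=
      ⟨hu, hmemU₀ ((chart Q₀).symm u)⟩
    refine (hol Q₀ U₀ sℓ u hu').congr (Eventually.of_forall fun w => ?_)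
    show evalOrZero (⊤ : W.left.Opens) sℓ ((chart Q₀).symm w) = ℓ ((ι ∘ (chart Q₀).symm) w)
    rw [hsℓ, MvPolynomial.aeval_X]; rfl
  ------------------------------------------------------------------
  -- Step 3: the analytic extension `Φ` of `chart Q₀ ∘ ι⁻¹` near `c₀`
  ------------------------------------------------------------------
  obtain ⟨U₁, xs, hsrc, hxs⟩ := alg Q₀
  have hQ₀U₁ : Q₀.pt ∈ (↑U₁ : W.left.Opens) := hsrc (mem Q₀)
  choose Oc Φc hOc hmemc hanc heqc using fun i => hloc (↑U₁) (xs i) Q₀ hQ₀U₁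
  set Oe : Set (𝔸 × 𝔸) := ⋂ i, Oc i with hOe
  have hOe_open : IsOpen Oe := isOpen_iInter_of_finite hOc
  have hc₀Oe : ι Q₀ ∈ Oe := mem_iInter.2 hmemc
  set Φ : 𝔸 × 𝔸 → (Fin d → ℝ) := fun z i => Φc i z with hΦ
  have hΦan : AnalyticOnNhd ℝ Φ Oe := fun z hz =>
    analyticAt_pi_iff.2 fun i => hanc i z (mem_iInter.1 hz i)
  have hΦeq : ∀ Q ∈ (chart Q₀).source, ι Q ∈ Oe → chart Q₀ Q = Φ (ι Q) := fun Q hQ hQO => by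
    funext i
    rw [hxs Q hQ i]
    exact heqc i Q (hsrc hQ) (mem_iInter.1 hQO i)
  -- a neighbourhood `N` of `c₀` with `ι⁻¹ N ⊆ (chart Q₀).source`
  obtain ⟨N, hNsub, hNopen, hc₀N⟩ : ∃ N : Set (𝔸 × 𝔸), ι ⁻¹' N ⊆ (chart Q₀).source ∧
      IsOpen N ∧ ι Q₀ ∈ N := by
    have h1 : (chart Q₀).source ∈ 𝓝 Q₀ := (chart Q₀).open_source.mem_nhds (mem Q₀)
    rw [hιind.nhds_eq_comap, Filter.mem_comap] at h1
    obtain ⟨N', hN', hsub⟩ := h1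
    obtain ⟨N, hNN', hNopen, hN⟩ := mem_nhds_iff.1 hN'
    exact ⟨N, (Set.preimage_mono hNN').trans hsub, hNopen, hN⟩
  ------------------------------------------------------------------
  -- Step 4: the analytic diffeomorphism `Λ`
  ------------------------------------------------------------------
  have hΘan : AnalyticOnNhd ℝ (fun z : 𝔸 × 𝔸 => z.1 * (1 + z.2)) univ := fun z _ =>
    analyticAt_fst.fun_mul (analyticAt_const.fun_add analyticAt_snd)
  have hΨan : ∀ v : Fin D → ℝ, AnalyticAt ℝ (fun v : Fin D → ℝ => x + Taff.symm v) v := fun v =>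
    analyticAt_const.fun_add ((Taff.symm : (Fin D → ℝ) →L[ℝ] 𝔸).analyticAt v)
  obtain ⟨Λf, hΛf⟩ : ∃ Λf : (Fin d → ℝ) → (Fin D → ℝ), ∀ u,
      Λf u = Taff ((ι ((chart Q₀).symm u)).1 * (1 + (ι ((chart Q₀).symm u)).2) - x) :=
    ⟨_, fun _ => rfl⟩
  obtain ⟨Λg, hΛg⟩ : ∃ Λg : (Fin D → ℝ) → (Fin d → ℝ), ∀ v,
      Λg v = Φ (q (x + Taff.symm v), a (x + Taff.symm v)) := ⟨_, fun _ => rfl⟩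
  set O₁ : Set (Fin d → ℝ) := (chart Q₀).target ∩
    (chart Q₀).symm ⁻¹' (ι ⁻¹' ({z : 𝔸 × 𝔸 | ‖z.2‖ < rt} ∩ Oe)) with hO₁
  set O₂ : Set (Fin D → ℝ) := ({v : Fin D → ℝ | x + Taff.symm v ∈ T} ∩
    (fun v : Fin D → ℝ => (q (x + Taff.symm v), a (x + Taff.symm v))) ⁻¹' (Oι ∩ N ∩ Oe)) ∩ V
    with hO₂
  have hO₁open : IsOpen O₁ :=
    (chart Q₀).isOpen_inter_preimage_symm (hιcont.isOpen_preimage _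
      ((isOpen_lt (continuous_norm.comp continuous_snd) continuous_const).inter hOe_open))
  have hpair : ContinuousOn (fun v : Fin D → ℝ => (q (x + Taff.symm v), a (x + Taff.symm v)))
      {v : Fin D → ℝ | x + Taff.symm v ∈ T} := by
    intro v hv
    exact (((hqan _ hv).fun_comp_of_eq (hΨan v) rfl).prod
      ((haan _ hv).fun_comp_of_eq (hΨan v) rfl)).continuousAt.continuousWithinAt
  have hO₂open : IsOpen O₂ := by
    refine (hpair.isOpen_inter_preimage ?_ ((hOι.inter hNopen).inter hOe_open)).inter hV
    exact hT.preimage (continuous_const.add Taff.symm.continuous)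
  -- the two inverse identities
  have hleft : ∀ u ∈ O₁, Λg (Λf u) = u := by
    rintro u ⟨hu, hu'⟩
    obtain ⟨hn, hQOe⟩ : ‖(ι ((chart Q₀).symm u)).2‖ < rt ∧ ι ((chart Q₀).symm u) ∈ Oe := hu'
    have hQsrc : (chart Q₀).symm u ∈ (chart Q₀).source := (chart Q₀).map_target hu
    obtain ⟨h1C, h2C⟩ : (ι ((chart Q₀).symm u)).1 ∈ H ∧ (ι ((chart Q₀).symm u)).2 ∈ 𝔨 :=
      hιC ((chart Q₀).symm u)
    obtain ⟨hq', ha'⟩ := hqa _ h1C _ h2C hn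
    rw [hΛg, hΛf, ContinuousLinearEquiv.symm_apply_apply, add_sub_cancel, hq', ha', Prod.mk.eta,
      ← hΦeq _ hQsrc hQOe, (chart Q₀).right_inv hu]
  have hΛf' : ∀ Q ∈ (chart Q₀).source, Λf (chart Q₀ Q) = Taff ((ι Q).1 * (1 + (ι Q).2) - x) :=
    fun Q hQ => by rw [hΛf, (chart Q₀).left_inv hQ]
  have hright : ∀ v ∈ O₂, Λf (Λg v) = v := by
    rintro v ⟨⟨hvT, ⟨hOι', hN'⟩, hOe'⟩, -⟩
    obtain ⟨hqH, hak, -, hMeq⟩ := hrep _ hvT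
    have hzC : (q (x + Taff.symm v), a (x + Taff.symm v)) ∈ Set.range ι := by
      rw [hrangeι]; exact ⟨⟨hqH, hak⟩, hOι'⟩
    obtain ⟨Q, hQ⟩ := hzC
    have hQsrc : Q ∈ (chart Q₀).source := hNsub (show ι Q ∈ N by rw [hQ]; exact hN')
    have hQOe : ι Q ∈ Oe := by rw [hQ]; exact hOe'
    rw [hΛg, ← hQ, ← hΦeq Q hQsrc hQOe, hΛf' Q hQsrc, hQ]
    dsimp only
    rw [← hMeq, add_sub_cancel_left, ContinuousLinearEquiv.apply_symm_apply]
  -- analyticity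
  have hΛfan : AnalyticOnNhd ℝ Λf (chart Q₀).target := by
    have hfun : Λf = (fun M : 𝔸 => Taff (M - x)) ∘ (fun z : 𝔸 × 𝔸 => z.1 * (1 + z.2)) ∘
        (ι ∘ (chart Q₀).symm) := funext fun u => by simp only [Function.comp_apply, hΛf]
    rw [hfun]
    refine AnalyticOnNhd.comp (t := univ) (fun M _ => ?_) (hΘan.comp hιan (mapsTo_univ _ _))
      (mapsTo_univ _ _)
    exact ((Taff : 𝔸 →L[ℝ] (Fin D → ℝ)).analyticAt _).fun_comp (analyticAt_id.fun_sub
      analyticAt_const)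
  have hΛgan : AnalyticOnNhd ℝ Λg O₂ := by
    rintro v ⟨⟨hvT, -, hOe'⟩, -⟩
    have hfun : Λg = Φ ∘ fun v : Fin D → ℝ => (q (x + Taff.symm v), a (x + Taff.symm v)) :=
      funext fun v => by simp only [Function.comp_apply, hΛg]
    rw [hfun]
    exact (hΦan _ hOe').comp_of_eq (((hqan _ hvT).fun_comp_of_eq (hΨan v) rfl).prod
      ((haan _ hvT).fun_comp_of_eq (hΨan v) rfl)) rfl
  -- the base point
  have hu₀O₁ : chart Q₀ Q₀ ∈ O₁ := by
    refine ⟨(chart Q₀).map_source (mem Q₀), ?_⟩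
    show ι ((chart Q₀).symm (chart Q₀ Q₀)) ∈ {z : 𝔸 × 𝔸 | ‖z.2‖ < rt} ∩ Oe
    rw [(chart Q₀).left_inv (mem Q₀)]
    refine ⟨?_, hc₀Oe⟩
    show ‖(ι Q₀).2‖ < rt
    rw [hιQ₀]; exact haxr
  have hΛfu₀ : Λf (chart Q₀ Q₀) = 0 := by
    rw [hΛf' Q₀ (mem Q₀), hιQ₀]
    show Taff (q x * (1 + a x) - x) = 0
    rw [← hxeq, sub_self, map_zero]
  have h0O₂ : (0 : Fin D → ℝ) ∈ O₂ := by
    refine ⟨⟨?_, ?_⟩, h0V⟩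
    · show x + Taff.symm 0 ∈ T
      rw [map_zero, add_zero]; exact hx
    · show (q (x + Taff.symm 0), a (x + Taff.symm 0)) ∈ Oι ∩ N ∩ Oe
      rw [map_zero, add_zero, ← hιQ₀]
      exact ⟨⟨hQ₀Oι, hc₀N⟩, hc₀Oe⟩
  -- the dimensions agree
  obtain rfl : D = d := by
    refine (eq_of_localInverse (Λ := Λf) (Λ' := Λg) (u := chart Q₀ Q₀)
      (hΛfan _ hu₀O₁.1).differentiableAt ?_ ?_ ?_).symm
    · rw [hΛfu₀]; exact (hΛgan 0 h0O₂).differentiableAt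
    · exact Filter.eventually_of_mem (hO₁open.mem_nhds hu₀O₁) hleft
    · rw [hΛfu₀]; exact Filter.eventually_of_mem (hO₂open.mem_nhds h0O₂) hright
  -- the diffeomorphism
  obtain ⟨Λ, hΛsrc, hΛtgt, hΛcoe, hΛsymm⟩ := exists_openPartialHomeomorph_of_inverses hO₁open
    hO₂open (hΛfan.continuousOn.mono inter_subset_left) hΛgan.continuousOn hleft hright
  have hΛan : AnalyticOnNhd ℝ Λ Λ.source := by
    rw [hΛcoe, hΛsrc]; exact hΛfan.mono (inter_subset_left.trans inter_subset_left)
  have hΛsan : AnalyticOnNhd ℝ Λ.symm Λ.target := by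
    rw [hΛsymm, hΛtgt]; exact hΛgan.mono inter_subset_left
  have hu₀src : chart Q₀ Q₀ ∈ Λ.source := by
    rw [hΛsrc]; exact ⟨hu₀O₁, show Λf (chart Q₀ Q₀) ∈ O₂ by rw [hΛfu₀]; exact h0O₂⟩
  have h0tgt : (0 : Fin D → ℝ) ∈ Λ.target := by
    have := Λ.map_source hu₀src
    rwa [hΛcoe, hΛfu₀] at this
  have htgtV : Λ.target ⊆ V := by
    rw [hΛtgt]; exact fun v hv => hv.1.2
  have hsrcO₁ : Λ.source ⊆ O₁ := by rw [hΛsrc]; exact inter_subset_left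
  ------------------------------------------------------------------
  -- Step 5: under `Λ` the `F i` are regular functions on `W`
  ------------------------------------------------------------------
  have hdec : ∀ i, ∃ s : Γ(W.left, ⊤), ∀ v ∈ Λ.source,
      F i (Λ v) = evalOrZero (↑U₀ : W.left.Opens) s ((chart Q₀).symm v) := by
    intro i
    have key : ∀ v ∈ Λ.source, x + Taff.symm (Λ v) =
        (ι ((chart Q₀).symm v)).1 * (1 + (ι ((chart Q₀).symm v)).2) := fun v hv => by
      rw [hΛcoe, hΛf, ContinuousLinearEquiv.symm_apply_apply, add_sub_cancel]
    have key' : ∀ v ∈ Λ.source, ‖(ι ((chart Q₀).symm v)).2‖ < rt := fun v hv =>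
      ((hsrcO₁ hv).2 : ‖(ι ((chart Q₀).symm v)).2‖ < rt ∧ ι ((chart Q₀).symm v) ∈ Oe).1
    rcases hFshape i with hS | ⟨_, hG⟩
    · refine ⟨sS, fun v hv => ?_⟩
      obtain ⟨h1C, h2C⟩ := hιC ((chart Q₀).symm v)
      rw [hS]
      dsimp only
      rw [key v hv, (hqa _ h1C _ h2C (key' v hv)).1, hsS']
    · refine ⟨sG, fun v hv => ?_⟩
      obtain ⟨h1C, h2C⟩ := hιC ((chart Q₀).symm v)
      rw [hG]
      dsimp only
      rw [key v hv, (hqa _ h1C _ h2C (key' v hv)).2, hsG']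
  choose sF hsF using hdec
  have hsFne : ∀ i, sF i ≠ 0 := by
    intro i hzero
    obtain ⟨v, hvV, hv⟩ := hFne i
    apply hv
    have hΛ0 : ∀ w ∈ Λ.target, F i w = 0 := fun w hw => by
      have h := hsF i (Λ.symm w) (Λ.map_target hw)
      rw [Λ.right_inv hw, hzero] at h
      rw [h]
      exact evalOrZero_zero _ _
    have key := (hFan i).eqOn_zero_of_preconnected_of_eventuallyEq_zero hVc h0V
      (Filter.eventuallyEq_iff_exists_mem.2 ⟨Λ.target, Λ.open_target.mem_nhds h0tgt,
        fun w hw => hΛ0 w hw⟩)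
    exact key hvV
  ------------------------------------------------------------------
  -- Step 6: Hironaka on `W(ℝ)` and transport along `Λ`
  ------------------------------------------------------------------
  obtain ⟨M, tM, t2M, csM, hMM, g, hgO, hgsm, hgprop, hgbij, hgchart⟩ :=
    RealPoints.exists_resolutionData W chart hchart mem alg hol Q₀ U₀ (hmemU₀ Q₀) sF hsFne
      Λ.source Λ.open_source
  have hR : (chart Q₀).target ∩ (chart Q₀).symm ⁻¹' {Q | Q.pt ∈ (↑U₀ : W.left.Opens)} ∩
      Λ.source = Λ.source :=
    inter_eq_right.2 fun v hv => ⟨(hsrcO₁ hv).1, hmemU₀ ((chart Q₀).symm v)⟩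
  rw [hR] at hgO hgprop hgbij
  have hFF' : ∀ i, ∀ v ∈ Λ.source, F i (Λ v) =
      (fun (i : Fin 2) (w : Fin D → ℝ) => evalOrZero (↑U₀ : W.left.Opens) (sF i)
        ((chart Q₀).symm w)) i v := fun i v hv => hsF i v hv
  obtain ⟨h1, h2, h3, h4, h5⟩ := Resolution.transport (F := F)
    (F' := fun (i : Fin 2) (w : Fin D → ℝ) => evalOrZero (↑U₀ : W.left.Opens) (sF i)
      ((chart Q₀).symm w)) Λ hΛan hΛsan hFF' hgO hgsm hgprop hgbij hgchart
  exact ⟨Λ.target, M, tM, t2M, csM, hMM, Λ ∘ g, Λ.open_target, h0tgt, htgtV, h1, h2, h3, h4, h5⟩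

end Resolution

section Main

variable {G : Type} [Group G] [TopologicalSpace G] [IsTopologicalGroup G] [CompactSpace G]
  [MeasurableSpace G] [BorelSpace G]

-- The product topology of `(M_N(ℂ))^E` and the topology of its norm are only reducibly-different
-- instances (tree idiom, cf. `WilsonPartitionLaplaceForm.lean`).
set_option backward.isDefEq.respectTransparency false in
set_option maxHeartbeats 800000 in
/-- **`WilsonPartitionRegularVariation` holds**: for a compact group `G` with a faithful continuous
unitary matrix representation `r` and a torus side `L ≥ 1`, the Wilson partition function is
regularly varying at zero temperature in the power-log scale,
`Z_L(β) β^λ (log β)^{-m} → C > 0`. Degree `0`: `G` is trivial (`tendsto_partitionFunction_of_finite`).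
Degree `≥ 1`: `Z_L(β) = c ∫_Ω e^{-β S(q M)} dμ` over the tube of `ρ^E(G^E)`
(`exists_partitionFunction_eq_tubeIntegral`), and the leading-term Laplace asymptotics
(`laplaceAsymptotics_of_localResolution`) apply because resolution data exist at every zero of
the phase (`exists_resolution_at`: Chevalley's algebraicity of compact linear groups, a smooth
algebraic model of `ρ^E(G^E) × 𝔨`, and Hironaka–Kollár resolution on its real points).
[cite: ArnoldGuseinzadeVarchenko2012, Part II §7.3 Thm. 7.5 §§1–2, 4 and Thm. 7.6]
[cite: Lin2017, Thm. 2.9] [cite: WatanabeSumio2009, Thm. 7.1] -/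
theorem WilsonPartitionRegularVariation_holds : WilsonPartitionRegularVariation := by
  intro G _ _ _ _ _ _ r L _
  classical
  rcases Nat.eq_zero_or_pos r.N with hN | hN
  · -- degree `0`: the faithful representation forces `G` to be trivial, in particular finite
    haveI : Subsingleton (Matrix (Fin r.N) (Fin r.N) ℂ) := by
      rw [hN]; infer_instance
    haveI : Finite G := @Finite.of_subsingleton G (r.injective.subsingleton)
    obtain ⟨C, hC, h⟩ := tendsto_partitionFunction_of_finite r L
    exact ⟨C, 0, 0, hC, le_rfl, h⟩
  · letI : MeasurableSpace (Edge 4 L → Matrix (Fin r.N) (Fin r.N) ℂ) := borel _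
    haveI : BorelSpace (Edge 4 L → Matrix (Fin r.N) (Fin r.N) ℂ) := ⟨rfl⟩
    obtain ⟨𝔨, rt, T, Ω, q, a, S, Gc, c, hrt, hTopen, -, hqa, hrep, hqan, haan, ⟨PS, hPS⟩,
      ⟨PG, hPG⟩, hSρ, hΩT, hΩcpt, h1int, hΩeq, hc, hZ⟩ :=
      exists_partitionFunction_eq_tubeIntegral r L
    haveI : Nonempty (Fin r.N) := ⟨⟨0, hN⟩⟩
    have hdim : 0 < Module.finrank ℝ (Edge 4 L → Matrix (Fin r.N) (Fin r.N) ℂ) :=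
      Module.finrank_pos
    set ρE : GaugeConfig 4 L G →* (Edge 4 L → Matrix (Fin r.N) (Fin r.N) ℂ) :=
      MonoidHom.compLeft r.ρ (Edge 4 L) with hρE
    have hΩmeas : MeasurableSet Ω := hΩcpt.isClosed.measurableSet
    -- analyticity of the phase and of the constraint
    have hSan : ∀ M, AnalyticAt ℝ S M := fun M => by
      have h := analyticAt_aeval_coeFn PS M
      rwa [show (MvPolynomial.aeval (R := ℝ)
        (fun ℓ : (Edge 4 L → Matrix (Fin r.N) (Fin r.N) ℂ) →L[ℝ] ℝ =>
          (ℓ : (Edge 4 L → Matrix (Fin r.N) (Fin r.N) ℂ) → ℝ)) PS :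
          (Edge 4 L → Matrix (Fin r.N) (Fin r.N) ℂ) → ℝ) = S from funext hPS] at h
    have hGan : ∀ M, AnalyticAt ℝ Gc M := fun M => by
      have h := analyticAt_aeval_coeFn PG M
      rwa [show (MvPolynomial.aeval (R := ℝ)
        (fun ℓ : (Edge 4 L → Matrix (Fin r.N) (Fin r.N) ℂ) →L[ℝ] ℝ =>
          (ℓ : (Edge 4 L → Matrix (Fin r.N) (Fin r.N) ℂ) → ℝ)) PG :
          (Edge 4 L → Matrix (Fin r.N) (Fin r.N) ℂ) → ℝ) = Gc from funext hPG] at h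
    have hfan : AnalyticOnNhd ℝ (fun M => S (q M)) T := fun M hM => (hSan (q M)).comp (hqan M hM)
    have hgan : AnalyticOnNhd ℝ (fun M => Gc (a M)) T := fun M hM =>
      (hGan (a M)).comp (haan M hM)
    -- nonnegativity and the zero of the phase
    have hf0 : ∀ M ∈ Ω, 0 ≤ S (q M) := fun M hM => by
      obtain ⟨U, hU⟩ := (hrep M (hΩT hM)).1
      rw [← hU, hSρ]
      exact r.wilsonAction_nonneg U
    have hq1 : q 1 = 1 := by
      have h := (hqa 1 ⟨1, map_one _⟩ 0 𝔨.zero_mem (by rw [norm_zero]; exact hrt)).1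
      rwa [add_zero, mul_one] at h
    have hS1 : S (q 1) = 0 := by
      rw [hq1, show (1 : Edge 4 L → Matrix (Fin r.N) (Fin r.N) ℂ) = ρE 1 by rw [map_one], hSρ]
      exact wilsonAction_one_eq_zero r.ρ
    -- `C = H × 𝔨` is real Zariski closed
    have hsepC : ∀ z ∉ {z : (Edge 4 L → Matrix (Fin r.N) (Fin r.N) ℂ) ×
        (Edge 4 L → Matrix (Fin r.N) (Fin r.N) ℂ) | z.1 ∈ Set.range ρE ∧ z.2 ∈ 𝔨},
        ∃ P : MvPolynomial (((Edge 4 L → Matrix (Fin r.N) (Fin r.N) ℂ) ×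
          (Edge 4 L → Matrix (Fin r.N) (Fin r.N) ℂ)) →L[ℝ] ℝ) ℝ,
          (∀ c ∈ {z : (Edge 4 L → Matrix (Fin r.N) (Fin r.N) ℂ) ×
              (Edge 4 L → Matrix (Fin r.N) (Fin r.N) ℂ) | z.1 ∈ Set.range ρE ∧ z.2 ∈ 𝔨},
            MvPolynomial.aeval (R := ℝ) (fun ℓ : ((Edge 4 L → Matrix (Fin r.N) (Fin r.N) ℂ) ×
              (Edge 4 L → Matrix (Fin r.N) (Fin r.N) ℂ)) →L[ℝ] ℝ =>
                (ℓ : (Edge 4 L → Matrix (Fin r.N) (Fin r.N) ℂ) ×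
                  (Edge 4 L → Matrix (Fin r.N) (Fin r.N) ℂ) → ℝ)) P c = 0) ∧
          MvPolynomial.aeval (R := ℝ) (fun ℓ : ((Edge 4 L → Matrix (Fin r.N) (Fin r.N) ℂ) ×
              (Edge 4 L → Matrix (Fin r.N) (Fin r.N) ℂ)) →L[ℝ] ℝ =>
                (ℓ : (Edge 4 L → Matrix (Fin r.N) (Fin r.N) ℂ) ×
                  (Edge 4 L → Matrix (Fin r.N) (Fin r.N) ℂ) → ℝ)) P z ≠ 0 := by
      intro z hz
      rw [mem_setOf_eq, not_and_or] at hz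
      rcases hz with h1 | h2
      · obtain ⟨P, hP0, hPz⟩ := exists_poly_vanishing_on_range_ne_zero r z.1 h1
        obtain ⟨P2, hP2⟩ := exists_aeval_coeFn_eq_comp_clm
          (f := fun y : Edge 4 L → Matrix (Fin r.N) (Fin r.N) ℂ => MvPolynomial.aeval (R := ℝ)
            (fun ℓ : (Edge 4 L → Matrix (Fin r.N) (Fin r.N) ℂ) →L[ℝ] ℝ =>
              (ℓ : (Edge 4 L → Matrix (Fin r.N) (Fin r.N) ℂ) → ℝ)) P y)
          ⟨P, fun _ => rfl⟩
          (ContinuousLinearMap.fst ℝ (Edge 4 L → Matrix (Fin r.N) (Fin r.N) ℂ)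
            (Edge 4 L → Matrix (Fin r.N) (Fin r.N) ℂ))
        refine ⟨P2, fun c hc => ?_, ?_⟩
        · obtain ⟨U, hU⟩ := hc.1
          rw [hP2]
          show MvPolynomial.aeval (R := ℝ)
            (fun ℓ : (Edge 4 L → Matrix (Fin r.N) (Fin r.N) ℂ) →L[ℝ] ℝ =>
              (ℓ : (Edge 4 L → Matrix (Fin r.N) (Fin r.N) ℂ) → ℝ)) P c.1 = 0
          rw [← hU]
          exact hP0 U
        · rw [hP2]
          exact hPz
      · obtain ⟨f, hfz, hfK⟩ := Submodule.exists_dual_map_eq_bot_of_notMem h2 inferInstance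
        set ℓ : ((Edge 4 L → Matrix (Fin r.N) (Fin r.N) ℂ) ×
            (Edge 4 L → Matrix (Fin r.N) (Fin r.N) ℂ)) →L[ℝ] ℝ :=
          LinearMap.toContinuousLinearMap
            (f ∘ₗ LinearMap.snd ℝ (Edge 4 L → Matrix (Fin r.N) (Fin r.N) ℂ)
              (Edge 4 L → Matrix (Fin r.N) (Fin r.N) ℂ)) with hℓ
        have hℓapply : ∀ w : (Edge 4 L → Matrix (Fin r.N) (Fin r.N) ℂ) ×
            (Edge 4 L → Matrix (Fin r.N) (Fin r.N) ℂ), ℓ w = f w.2 := fun w => rfl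
        refine ⟨MvPolynomial.X ℓ, fun c hc => ?_, ?_⟩
        · rw [MvPolynomial.aeval_X]
          show ℓ c = 0
          rw [hℓapply]
          have hmem : f c.2 ∈ 𝔨.map f := Submodule.mem_map_of_mem hc.2
          rwa [hfK, Submodule.mem_bot] at hmem
        · rw [MvPolynomial.aeval_X]
          show ℓ z ≠ 0
          rw [hℓapply]
          exact hfz
    have hhomC := exists_affine_auto_of_mem_prod (E' := Edge 4 L) r 𝔨
    -- the Laplace asymptotics
    obtain ⟨C, lam, m, hC, hlam, -, hlim⟩ := laplaceAsymptotics_of_localResolution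
      (Module.finBasis ℝ (Edge 4 L → Matrix (Fin r.N) (Fin r.N) ℂ)).addHaar hdim
      (U := T) (f := fun M => S (q M)) (l := 1) (g := fun _ M => Gc (a M)) (φ := fun _ => (1 : ℝ))
      hTopen hfan (fun _ => hgan) contDiffOn_const (by simpa [← hΩeq] using hΩcpt)
      (fun x _ => one_pos) ⟨1, by simpa [← hΩeq] using h1int, hS1⟩
      (fun x hx _ Taff V F hV hVc h0V hFan _ hFne hFshape =>
        exists_resolution_at (H := Set.range ρE) (𝔨 := 𝔨) hsepC hhomC hTopen hqa hrep
          hqan haan hPS hPG hx.1 Taff hV hVc h0V hFan hFne hFshape)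
    have hlim' : Tendsto (fun τ : ℝ => τ ^ (lam : ℝ) / Real.log τ ^ m *
        ∫ x in Ω, Real.exp (-(τ * |S (q x)|))
          ∂(Module.finBasis ℝ (Edge 4 L → Matrix (Fin r.N) (Fin r.N) ℂ)).addHaar) atTop (𝓝 C) := by
      simpa [← hΩeq] using hlim
    have hint : ∀ τ : ℝ, ∫ x in Ω, Real.exp (-(τ * |S (q x)|))
        ∂(Module.finBasis ℝ (Edge 4 L → Matrix (Fin r.N) (Fin r.N) ℂ)).addHaar =
        ∫ x in Ω, Real.exp (-(τ * S (q x)))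
          ∂(Module.finBasis ℝ (Edge 4 L → Matrix (Fin r.N) (Fin r.N) ℂ)).addHaar := fun τ =>
      setIntegral_congr_fun hΩmeas fun x hx => by rw [abs_of_nonneg (hf0 x hx)]
    simp_rw [hint] at hlim'
    refine ⟨c * C, lam, m, mul_pos hc hC, by exact_mod_cast hlam, ?_⟩
    refine (hlim'.const_mul c).congr' (Eventually.of_forall fun β => ?_)
    dsimp only
    rw [hZ β]
    ring

end Main

end Literature.MathematicalPhysics.QuantumFieldTheory

end
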